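import Literature.Computability.Complexity.BrickAlgebra
import Literature.Computability.Complexity.StackBricksArith
import Literature.Computability.Complexity.StackBricksLists
import Literature.Computability.Complexity.StringEquality
import HarnessLib

/-!
# List-fold bricks: folding an `FP` step over a coded list, `all`/`any`, products, membership

Trunk `CplxCore`, continuing `BrickAlgebra.lean` (records, projections `fstF`/`sndF`/`nthF`/`sndPow`,
one-bit conditions, `iteFn`/`andFn`/`notFn`) and `IterateFPGrowth.lean` (`iterate_mem_FP_of_growth`:
polynomially many rounds of a first-field-preserving `FP` round function of linear growth). Lists of
strings are coded by nested pairs, `encList [a₀, …, aₖ₋₁] = ⟨a₀, ⟨a₁, … ⟨aₖ₋₁, ε⟩…⟩⟩`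
(`StackLists.lean`). This file provides the generic **fold of an `FP` step function over the ITEMS of
a coded list**, as a total `FP` string function with a closed-form value on *every* input, and the
derived bricks a certificate verifier is assembled from. Its sibling `FoldBricks.lean` is the
*indexed* fold `Brick.foldLoop op f p` (`acc := op ⟨acc, f ⟨x, 1ⁱ⟩⟩` for `i < k`, with its own
product instance `foldAcc_prodFn`); here the loop runs over the items of a list read off the input.

* `Brick.decNil` — the total decoder the fold implements: split off pair components (`fstF`/`sndF`)
  until the string is empty; `decNil (encList l) = l` (`decNil_encList`), at most `|L|` items. This
  is a SECOND total decoder of the `encList` coding next to `Brick.decItems` (`StackBricksLists.lean`,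
  the re-parse behind `isortFn`, which stops at the first remainder that is not `wellPaired`); the
  two agree on genuine codes (`decNil_encList_eq_decItems`) and DIFFER on malformed strings — e.g.
  `decItems [1] = []` but `decNil [1] = [ε]` (`fstF [1] = sndF [1] = ε`), likewise on a leading `10`
  pair — see the design notes;
* `Brick.foldRound step`, `Brick.foldFn step ini` — on input `w` (context = the whole `w`, list
  `L = sndF w`), `foldFn step ini w = (decNil L).foldl (fun acc a => step ⟨w, ⟨a, acc⟩⟩) (ini w)`
  (`foldFn_apply`), and **`foldFn_mem_FP`** for `step, ini ∈ FP` with the growth bound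
  `|step ⟨u, ⟨a, acc⟩⟩| ≤ |acc| + 4|a| + c (|u| + 1)` (stated totally, `FoldGrowth`);
* `Brick.orFn` (disjunction of one-bit conditions, complementing `andFn`/`notFn`),
  `Brick.allFn c` (`⟨x, L⟩ ↦ [∀ a ∈ decNil L, c ⟨x, a⟩ = [1]]`, for a one-bit `c`), `Brick.anyFn c`,
  `Brick.eqValFn` (`⟨a, b⟩ ↦ [⟦a⟧ = ⟦b⟧]`, equality of binary values), `Brick.memHeadFn`
  (`⟨q, L⟩ ↦ [some item of L has first field of value ⟦q⟧]`), `Brick.prodListFn`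
  (`⟨x, L⟩ ↦ encodeNat (∏ ⟦a⟧, a ∈ decNil L)`), each with its value on all inputs, `OneBit` where
  applicable, and membership in `FP`.

Numerals are read by `bitsToNat` (total) and written canonically (`encodeNat`).

## Design notes

* The fold's semantics is stated for ALL strings through the total decoder `decNil`, not only for
  genuine codes `encList l`: a verifier built from these bricks alone is then analysable on
  malformed certificates without a separate well-formedness pass. `decNil` (and not the existing
  `Brick.decItems`) is used because it is literally the decoder that the `fstF`/`sndF`-driven round
  `foldRound` implements (test `isNilFn`, then `boolUnpair`), which is what makes `foldFn_apply`
  hold on every input with no side condition. CAVEAT: `decNil` and `decItems` parse malformed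
  strings differently (`decItems [1] = []`, `decNil [1] = [ε]`); only `encList`-images are common
  ground (`decNil_encList_eq_decItems`), so a verifier mixing a `decItems`-based brick (`isortFn`,
  `takeItemsFn`) with the bricks of this file must not rely on the two readings of one malformed
  string agreeing — re-encode first (`encList ∘ decItems`, `Brick.reparseC`) if both are needed.
* The context handed to the step is the whole input `w = ⟨x, L⟩` (the step projects what it needs);
  the round keeps `w` as the preserved first field of the iteration record `⟨w, ⟨rest, acc⟩⟩`, whose
  length also clocks the `|w| ≥ |L| ≥ #items` rounds.

## References

* S. Arora, B. Barak, *Computational Complexity: A Modern Approach*, CUP 2009, §1.3 (polynomial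
  time is closed under composition and bounded loops), §0.1 (coding of tuples and lists).
-/

namespace Literature.Computability.Complexity

open _root_.Computability

namespace Brick

/-! ### The total decoder -/

/-- The second component of a nonempty string is shorter. [folklore] -/
theorem length_sndF_lt : ∀ {w : List Bool}, w ≠ [] → (sndF w).length < w.length
  | [], h => absurd rfl h
  | [b], _ => by simp [sndF, boolUnpair]
  | b :: b' :: rest, _ => by
    have h2 := length_fstF_sndF_le (b :: b' :: rest)
    by_cases hbb : b = b'
    · subst hbb
      by_cases hr : rest = []
      · subst hr; simp [sndF, boolUnpair]
      · have ih := length_sndF_lt hr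
        simp only [sndF, boolUnpair, if_true] at ih ⊢
        simp only [List.length_cons]
        omega
    · cases b' <;> simp [sndF, boolUnpair, hbb]

/-- **The total decoder of coded lists implemented by the fold**: split off the two pair components
(`fstF`/`sndF`, i.e. `boolUnpair`) while the string is nonempty. On genuine codes it inverts `encList`
(`decNil_encList`) and agrees with the tree's other total decoder `Brick.decItems` of
`StackBricksLists.lean` (`decNil_encList_eq_decItems`); on malformed strings the two differ
(`decItems` stops at the first non-`wellPaired` remainder: `decItems [1] = []`, whereas
`decNil [1] = [ε]`). [cite: AroraBarak2009, §0.1 (coding of lists)] -/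
def decNil (L : List Bool) : List (List Bool) :=
  if _h : L = [] then [] else fstF L :: decNil (sndF L)
termination_by L.length
decreasing_by exact length_sndF_lt _h

/-- The empty string codes the empty list. [folklore] -/
@[simp] theorem decNil_nil : decNil [] = [] := by
  rw [decNil]; simp

/-- A nonempty string codes its first component followed by the items of its second. [folklore] -/
theorem decNil_of_ne_nil {L : List Bool} (h : L ≠ []) : decNil L = fstF L :: decNil (sndF L) := by
  rw [decNil]; simp [h]

/-- Decoding a cons. [folklore] -/
@[simp] theorem decNil_boolPair (a L : List Bool) : decNil (boolPair a L) = a :: decNil L := by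
  rw [decNil_of_ne_nil (by intro h; simpa using congrArg List.length h)]; simp [fstF, sndF]

/-- **`decNil` inverts `encList`.** [folklore] -/
@[simp] theorem decNil_encList : ∀ l : List (List Bool), decNil (encList l) = l
  | [] => decNil_nil
  | a :: l => by rw [encList_cons, decNil_boolPair, decNil_encList l]

/-- **Common ground with `Brick.decItems`**: the two total decoders agree on genuine codes (both
invert `encList`); they differ on malformed strings, see the module docstring. [folklore] -/
theorem decNil_encList_eq_decItems (l : List (List Bool)) : decNil (encList l) = decItems (encList l) := by
  rw [decNil_encList, decItems_encList]

/-- At most `|L|` items. [folklore] -/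
theorem length_decNil_le (L : List Bool) : (decNil L).length ≤ L.length := by
  induction L using decNil.induct with
  | case1 => simp
  | case2 L h ih =>
    rw [decNil_of_ne_nil h]
    have h2 := length_sndF_lt h
    simp only [List.length_cons]
    omega

/-- The items are short: `Σ 2|a| ≤ |L|`. [folklore] -/
theorem sum_decNil_le (L : List Bool) : ((decNil L).map fun a => 2 * a.length).sum ≤ L.length := by
  induction L using decNil.induct with
  | case1 => simp
  | case2 L h ih =>
    rw [decNil_of_ne_nil h]
    have h1 := length_fstF_sndF_le L
    simp only [List.map_cons, List.sum_cons]
    omega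

/-- Items are short: `2|a| ≤ |L|` for `a ∈ decNil L`. [folklore] -/
theorem two_mul_length_le_of_mem_decNil {L a : List Bool} (h : a ∈ decNil L) : 2 * a.length ≤ L.length :=
  le_trans (List.single_le_sum (fun _ _ => Nat.zero_le _) _ (List.mem_map.2 ⟨a, h, rfl⟩)) (sum_decNil_le L)

/-! ### One round of the fold -/

/-- The argument handed to the step in a running round: `⟨u, ⟨fstF L, acc⟩⟩` from the record
`⟨u, ⟨L, acc⟩⟩`. [folklore] -/
noncomputable def stepArg : List Bool → List Bool :=
  fanoutFn (nthF 0) (fanoutFn (fstF ∘ nthF 1) (sndPow 1))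

/-- `stepArg ∈ FP`. [folklore] -/
theorem stepArg_mem_FP : stepArg ∈ FP :=
  fanoutFn_mem_FP (nthF_mem_FP 0) (fanoutFn_mem_FP (comp_mem_FP fstF_mem_FP (nthF_mem_FP 1)) (sndPow_mem_FP 1))

/-- `stepArg` on a record. [folklore] -/
@[simp] theorem stepArg_apply (u L acc : List Bool) :
    stepArg (boolPair u (boolPair L acc)) = boolPair u (boolPair (fstF L) acc) := by
  simp [stepArg]

/-- **One round of the fold** on records `⟨u, ⟨L, acc⟩⟩`: if the unread list `L` is empty,
reassemble the record; otherwise keep `u`, replace `L` by its tail `sndF L` and the accumulator by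
`step ⟨u, ⟨fstF L, acc⟩⟩`. [cite: AroraBarak2009, §1.3 (bounded loops)] -/
noncomputable def foldRound (step : List Bool → List Bool) : List Bool → List Bool :=
  iteFn (isNilFn ∘ nthF 1) (fanoutFn (nthF 0) (fanoutFn (nthF 1) (sndPow 1)))
    (fanoutFn (nthF 0) (fanoutFn (sndF ∘ nthF 1) (step ∘ stepArg)))

/-- `foldRound step ∈ FP` for `step ∈ FP`. [folklore] -/
theorem foldRound_mem_FP {step : List Bool → List Bool} (h : step ∈ FP) : foldRound step ∈ FP :=
  iteFn_mem_FP (comp_mem_FP isNilFn_mem_FP (nthF_mem_FP 1))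
    (fanoutFn_mem_FP (nthF_mem_FP 0) (fanoutFn_mem_FP (nthF_mem_FP 1) (sndPow_mem_FP 1)))
    (fanoutFn_mem_FP (nthF_mem_FP 0) (fanoutFn_mem_FP (comp_mem_FP sndF_mem_FP (nthF_mem_FP 1)) (comp_mem_FP h stepArg_mem_FP)))

/-- **A finished fold idles**: empty unread list. [folklore] -/
theorem foldRound_nil (step : List Bool → List Bool) (u acc : List Bool) :
    foldRound step (boolPair u (boolPair [] acc)) = boolPair u (boolPair [] acc) := by
  rw [foldRound, iteFn_apply (b := true) (by simp [isNilFn])]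
  simp

/-- **A running fold steps**: the head item is consumed into the accumulator. [folklore] -/
theorem foldRound_of_ne_nil (step : List Bool → List Bool) (u acc : List Bool) {L : List Bool} (hL : L ≠ []) :
    foldRound step (boolPair u (boolPair L acc)) =
      boolPair u (boolPair (sndF L) (step (boolPair u (boolPair (fstF L) acc)))) := by
  rw [foldRound, iteFn_apply (b := false) (by simp [isNilFn, hL])]
  simp

/-- A running fold on a cons. [folklore] -/
theorem foldRound_boolPair (step : List Bool → List Bool) (u a L acc : List Bool) :
    foldRound step (boolPair u (boolPair (boolPair a L) acc)) =
      boolPair u (boolPair L (step (boolPair u (boolPair a acc)))) := by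
  rw [foldRound_of_ne_nil step u acc (by intro h; simpa using congrArg List.length h)]; simp [fstF, sndF]

/-- The round keeps the first field, on every input. [folklore] -/
theorem fstF_foldRound (step : List Bool → List Bool) (z : List Bool) : fstF (foldRound step z) = fstF z := by
  rw [foldRound, iteFn_of_oneBit (oneBit_isNilFn.comp _)]
  split_ifs <;> simp [← nthF_zero]

/-- `FoldGrowth c step`: the total growth bound on the step,
`|step v| ≤ |sndF (sndF v)| + 4 |fstF (sndF v)| + c (|fstF v| + 1)` — on a step argument
`v = ⟨u, ⟨a, acc⟩⟩` this reads `|step v| ≤ |acc| + 4|a| + c (|u| + 1)`. [folklore] -/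
def FoldGrowth (c : ℕ) (step : List Bool → List Bool) : Prop :=
  ∀ v : List Bool, (step v).length ≤ (sndF (sndF v)).length + 4 * (fstF (sndF v)).length + c * ((fstF v).length + 1)

/-- **Growth of one round**: under `FoldGrowth c step`, `|foldRound step z| ≤ |z| + (c + 4)(|fstF z| + 1)`
on every input. [folklore] -/
theorem length_foldRound_le {step : List Bool → List Bool} {c : ℕ} (hstep : FoldGrowth c step) (z : List Bool) :
    (foldRound step z).length ≤ z.length + (c + 4) * ((fstF z).length + 1) := by
  have h0 := length_fstF_sndF_le z
  have h1 := length_fstF_sndF_le (sndF z)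
  have h2 := length_fstF_sndF_le (fstF (sndF z))
  rw [foldRound, iteFn_of_oneBit (oneBit_isNilFn.comp _)]
  split_ifs
  · rw [length_fanoutFn, length_fanoutFn]
    simp only [nthF, sndPow, Function.comp_apply]
    nlinarith
  · rw [length_fanoutFn, length_fanoutFn]
    simp only [nthF, Function.comp_apply]
    have hs := hstep (stepArg z)
    have harg : stepArg z = boolPair (fstF z) (boolPair (fstF (fstF (sndF z))) (sndF (sndF z))) := by
      simp [stepArg, nthF, sndPow]
    rw [harg] at hs ⊢
    simp only [fstF_boolPair, sndF_boolPair] at hs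
    nlinarith

/-- **Semantics of the rounds**: with at least `#items` rounds available, the fold started on
`⟨u, ⟨L, acc⟩⟩` ends on `⟨u, ⟨ε, acc'⟩⟩` with `acc'` the left fold of the step over the items.
[folklore] -/
theorem iterate_foldRound (step : List Bool → List Bool) (u : List Bool) :
    ∀ (L acc : List Bool) (n : ℕ), (decNil L).length ≤ n →
      (foldRound step)^[n] (boolPair u (boolPair L acc)) =
        boolPair u (boolPair [] ((decNil L).foldl (fun acc a => step (boolPair u (boolPair a acc))) acc)) := by
  intro L
  induction L using decNil.induct with
  | case1 =>
    intro acc n _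
    rw [decNil_nil, List.foldl_nil]
    exact Function.iterate_fixed (foldRound_nil step u acc) n
  | case2 L hL ih =>
    intro acc n hn
    rw [decNil_of_ne_nil hL] at hn ⊢
    obtain ⟨n, rfl⟩ : ∃ m, n = m + 1 := ⟨n - 1, by simp at hn; omega⟩
    rw [Function.iterate_succ_apply, foldRound_of_ne_nil step u acc hL, List.foldl_cons]
    exact ih _ n (by simp at hn; omega)

/-! ### The fold brick -/

/-- **The fold brick**: on input `w` (list `L = sndF w`), start the record `⟨w, ⟨L, ini w⟩⟩`, run
`|w|` rounds (enough: `#items ≤ |L| ≤ |w|`) and return the accumulator. [cite: AroraBarak2009, §1.3 (bounded loops)] -/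
noncomputable def foldFn (step ini : List Bool → List Bool) : List Bool → List Bool :=
  sndPow 1 ∘ (fun z => (foldRound step)^[Polynomial.X.eval (boolUnpair z).1.length] z) ∘ fanoutFn id (fanoutFn sndF ini)

/-- **`foldFn step ini ∈ FP`** for `step, ini ∈ FP` with `FoldGrowth c step`. [cite: AroraBarak2009, §1.3, §1.4.1] -/
theorem foldFn_mem_FP {step ini : List Bool → List Bool} (hstep : step ∈ FP) (hini : ini ∈ FP) {c : ℕ}
    (hg : FoldGrowth c step) : foldFn step ini ∈ FP :=
  comp_mem_FP (sndPow_mem_FP 1) (comp_mem_FP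
    (iterate_mem_FP_of_growth (foldRound_mem_FP hstep) (c + 4) (fun w => fstF_foldRound step w)
      (fun w => length_foldRound_le hg w) Polynomial.X)
    (fanoutFn_mem_FP (PolyTimeComputable.id _) (fanoutFn_mem_FP sndF_mem_FP hini)))

/-- **Value of the fold brick on every input**: the left fold of the step over the items of
`sndF w`, from `ini w`, the step seeing `⟨w, ⟨item, acc⟩⟩`. [folklore] -/
theorem foldFn_apply (step ini : List Bool → List Bool) (w : List Bool) :
    foldFn step ini w = (decNil (sndF w)).foldl (fun acc a => step (boolPair w (boolPair a acc))) (ini w) := by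
  have hn : (decNil (sndF w)).length ≤ Polynomial.X.eval (boolUnpair (boolPair w (boolPair (sndF w) (ini w)))).1.length := by
    simp only [Polynomial.eval_X, boolUnpair_boolPair]
    have := length_fstF_sndF_le w
    exact (length_decNil_le _).trans (by omega)
  simp only [foldFn, Function.comp_apply, fanoutFn_apply, id]
  rw [iterate_foldRound step w (sndF w) (ini w) _ hn]
  simp [sndPow]

/-- Value of the fold brick on a pair `⟨x, L⟩`. [folklore] -/
theorem foldFn_boolPair (step ini : List Bool → List Bool) (x L : List Bool) :
    foldFn step ini (boolPair x L) =
      (decNil L).foldl (fun acc a => step (boolPair (boolPair x L) (boolPair a acc))) (ini (boolPair x L)) := by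
  rw [foldFn_apply]; simp [sndF]

/-! ### Disjunction of one-bit conditions -/

/-- `orFn c d`: the disjunction of two one-bit conditions, `c ? 1 : d`. [folklore] -/
noncomputable def orFn (c d : List Bool → List Bool) : List Bool → List Bool := iteFn c (fun _ => [true]) d

/-- Value of `orFn`. [folklore] -/
theorem orFn_apply {c d : List Bool → List Bool} {z : List Bool} {b b' : Bool} (h : c z = [b]) (h' : d z = [b']) :
    orFn c d z = [b || b'] := by
  rw [orFn, iteFn_apply h]
  cases b <;> simp [h']

/-- `orFn` of one-bit conditions is one-bit. [folklore] -/
theorem oneBit_orFn {c d : List Bool → List Bool} (hc : OneBit c) (hd : OneBit d) : OneBit (orFn c d) :=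
  hc.ite (oneBit_const true) hd

/-- `orFn c d ∈ FP`. [folklore] -/
theorem orFn_mem_FP {c d : List Bool → List Bool} (hc : c ∈ FP) (hd : d ∈ FP) : orFn c d ∈ FP :=
  iteFn_mem_FP hc (const_mem_FP _) hd

/-! ### `all` and `any` over a coded list -/

/-- The test "the accumulator is the bit `1`" as a total one-bit condition on step arguments
`⟨u, ⟨a, acc⟩⟩`: `[0 < ⟦acc⟧]`. [folklore] -/
noncomputable def accPosFn : List Bool → List Bool := ltFn ∘ fanoutFn (fun _ => []) (sndPow 1)

/-- `accPosFn ∈ FP`. [folklore] -/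
theorem accPosFn_mem_FP : accPosFn ∈ FP :=
  comp_mem_FP ltFn_mem_FP (fanoutFn_mem_FP (const_mem_FP _) (sndPow_mem_FP 1))

/-- `accPosFn` is one-bit. [folklore] -/
theorem oneBit_accPosFn : OneBit accPosFn := oneBit_ltFn.comp _

/-- `accPosFn` on a step argument. [folklore] -/
@[simp] theorem accPosFn_apply (u a acc : List Bool) :
    accPosFn (boolPair u (boolPair a acc)) = [decide (0 < bitsToNat acc)] := by
  simp [accPosFn]

/-- The item test of `allFn c` on step arguments: `c ⟨fstF u, a⟩` (the context is the first field
`x` of the brick's input `u = ⟨x, L⟩`). [folklore] -/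
noncomputable def itemTest (c : List Bool → List Bool) : List Bool → List Bool :=
  c ∘ fanoutFn (fstF ∘ nthF 0) (nthF 1)

/-- `itemTest c ∈ FP`. [folklore] -/
theorem itemTest_mem_FP {c : List Bool → List Bool} (hc : c ∈ FP) : itemTest c ∈ FP :=
  comp_mem_FP hc (fanoutFn_mem_FP (comp_mem_FP fstF_mem_FP (nthF_mem_FP 0)) (nthF_mem_FP 1))

/-- `itemTest c` on a step argument. [folklore] -/
@[simp] theorem itemTest_apply (c : List Bool → List Bool) (u a acc : List Bool) :
    itemTest c (boolPair u (boolPair a acc)) = c (boolPair (fstF u) a) := by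
  simp [itemTest]

/-- The step of `allFn c`: `[c-bit ∧ acc-bit]`. [folklore] -/
noncomputable def allStep (c : List Bool → List Bool) : List Bool → List Bool :=
  andFn (itemTest c) accPosFn

/-- `allStep c ∈ FP`. [folklore] -/
theorem allStep_mem_FP {c : List Bool → List Bool} (hc : c ∈ FP) : allStep c ∈ FP :=
  andFn_mem_FP (itemTest_mem_FP hc) accPosFn_mem_FP

/-- `allStep c` is one-bit for a one-bit `c`. [folklore] -/
theorem oneBit_allStep {c : List Bool → List Bool} (hc : OneBit c) : OneBit (allStep c) :=
  oneBit_andFn (hc.comp _) oneBit_accPosFn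

/-- A one-bit step has growth `1`. [folklore] -/
theorem foldGrowth_of_oneBit {step : List Bool → List Bool} (h : OneBit step) : FoldGrowth 1 step := fun v => by
  rw [h.length_eq]; omega

/-- **`allFn c ⟨x, L⟩ = [∀ a ∈ decNil L, c ⟨x, a⟩ = [1]]`** (for a one-bit `c`): the conjunction of a
test over the items of a coded list. [cite: AroraBarak2009, §1.3 (bounded loops)] -/
noncomputable def allFn (c : List Bool → List Bool) : List Bool → List Bool :=
  foldFn (allStep c) (fun _ => [true])

/-- **`allFn c ∈ FP`** for a one-bit `c ∈ FP`. [cite: AroraBarak2009, §1.3] -/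
theorem allFn_mem_FP {c : List Bool → List Bool} (hc : c ∈ FP) (h1 : OneBit c) : allFn c ∈ FP :=
  foldFn_mem_FP (allStep_mem_FP hc) (const_mem_FP _) (foldGrowth_of_oneBit (oneBit_allStep h1))

/-- The left fold of the `all`-step from a bit. [folklore] -/
theorem foldl_allStep {c : List Bool → List Bool} (hc : OneBit c) (w : List Bool) :
    ∀ (l : List (List Bool)) (b : Bool),
      l.foldl (fun acc a => allStep c (boolPair w (boolPair a acc))) [b] =
        [b && l.all fun a => decide (c (boolPair (fstF w) a) = [true])]
  | [], b => by simp
  | a :: l, b => by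
    obtain ⟨b', hb'⟩ := hc (boolPair (fstF w) a)
    rw [List.foldl_cons]
    have h1 : allStep c (boolPair w (boolPair a [b])) = [b' && b] := by
      have := andFn_apply (c := itemTest c) (d := accPosFn) (z := boolPair w (boolPair a [b])) (b := b') (b' := b)
        (by simp [hb']) (by cases b <;> simp)
      simpa [allStep] using this
    rw [h1, foldl_allStep hc w l]
    cases b <;> cases b' <;> simp [hb']

/-- **Value of `allFn` on every input.** [folklore] -/
theorem allFn_apply {c : List Bool → List Bool} (hc : OneBit c) (w : List Bool) :
    allFn c w = [(decNil (sndF w)).all fun a => decide (c (boolPair (fstF w) a) = [true])] := by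
  rw [allFn, foldFn_apply, foldl_allStep hc w]
  simp

/-- **Value of `allFn` on a pair.** [folklore] -/
theorem allFn_boolPair {c : List Bool → List Bool} (hc : OneBit c) (x L : List Bool) :
    allFn c (boolPair x L) = [decide (∀ a ∈ decNil L, c (boolPair x a) = [true])] := by
  rw [allFn_apply hc, fstF_boolPair, sndF_boolPair]
  congr 1
  rw [Bool.eq_iff_iff]
  simp

/-- `allFn c` is one-bit (for a one-bit `c`). [folklore] -/
theorem oneBit_allFn {c : List Bool → List Bool} (hc : OneBit c) : OneBit (allFn c) := fun w =>
  ⟨_, allFn_apply hc w⟩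

/-- **`anyFn c ⟨x, L⟩ = [∃ a ∈ decNil L, c ⟨x, a⟩ = [1]]`**: the disjunction, `¬ ∀ ¬`. [folklore] -/
noncomputable def anyFn (c : List Bool → List Bool) : List Bool → List Bool :=
  notFn (allFn (notFn c))

/-- `anyFn c ∈ FP` for a one-bit `c ∈ FP`. [folklore] -/
theorem anyFn_mem_FP {c : List Bool → List Bool} (hc : c ∈ FP) (h1 : OneBit c) : anyFn c ∈ FP :=
  notFn_mem_FP (allFn_mem_FP (notFn_mem_FP hc) (oneBit_notFn h1))

/-- `anyFn c` is one-bit. [folklore] -/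
theorem oneBit_anyFn {c : List Bool → List Bool} (hc : OneBit c) : OneBit (anyFn c) :=
  oneBit_notFn (oneBit_allFn (oneBit_notFn hc))

/-- **Value of `anyFn` on a pair.** [folklore] -/
theorem anyFn_boolPair {c : List Bool → List Bool} (hc : OneBit c) (x L : List Bool) :
    anyFn c (boolPair x L) = [decide (∃ a ∈ decNil L, c (boolPair x a) = [true])] := by
  rw [anyFn, notFn_apply (allFn_boolPair (oneBit_notFn hc) x L)]
  congr 1
  have hneg : ∀ a, notFn c (boolPair x a) = [true] ↔ ¬ c (boolPair x a) = [true] := fun a => by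
    obtain ⟨b, hb⟩ := hc (boolPair x a)
    rw [notFn_apply hb, hb]
    cases b <;> simp
  simp only [hneg]
  by_cases h : ∃ a ∈ decNil L, c (boolPair x a) = [true]
  · rw [decide_eq_true h]
    obtain ⟨a, ha, hca⟩ := h
    simp only [Bool.not_eq_true', decide_eq_false_iff_not, not_forall]
    exact ⟨a, ha, not_not.2 hca⟩
  · rw [decide_eq_false h]
    push Not at h
    simpa using h

/-! ### Equality of values and membership among heads -/

/-- **`eqValFn ⟨a, b⟩ = [⟦a⟧ = ⟦b⟧]`**: equality of binary values (not of strings), from two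
comparisons. [folklore] -/
noncomputable def eqValFn : List Bool → List Bool :=
  andFn (notFn ltFn) (notFn (ltFn ∘ fanoutFn sndF fstF))

/-- `eqValFn ∈ FP`. [folklore] -/
theorem eqValFn_mem_FP : eqValFn ∈ FP :=
  andFn_mem_FP (notFn_mem_FP ltFn_mem_FP) (notFn_mem_FP (comp_mem_FP ltFn_mem_FP (fanoutFn_mem_FP sndF_mem_FP fstF_mem_FP)))

/-- `eqValFn` is one-bit. [folklore] -/
theorem oneBit_eqValFn : OneBit eqValFn :=
  oneBit_andFn (oneBit_notFn oneBit_ltFn) (oneBit_notFn (oneBit_ltFn.comp _))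

/-- **Value of `eqValFn` on a pair.** [folklore] -/
@[simp] theorem eqValFn_boolPair (a b : List Bool) : eqValFn (boolPair a b) = [decide (bitsToNat a = bitsToNat b)] := by
  rw [eqValFn, andFn_apply (notFn_apply (ltFn_boolPair a b))
    (notFn_apply (c := ltFn ∘ fanoutFn sndF fstF) (b := decide (bitsToNat b < bitsToNat a)) (by simp))]
  congr 1
  by_cases h : bitsToNat a = bitsToNat b
  · simp [h]
  · rcases Nat.lt_or_gt_of_ne h with hlt | hgt
    · simp [hlt, h]
    · simp [h, hgt, Nat.lt_asymm hgt]

/-- The head test of `memHeadFn`: on `⟨q, item⟩`, `[⟦q⟧ = ⟦fstF item⟧]`. [folklore] -/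
noncomputable def headEqFn : List Bool → List Bool := eqValFn ∘ fanoutFn fstF (fstF ∘ sndF)

/-- `headEqFn ∈ FP`. [folklore] -/
theorem headEqFn_mem_FP : headEqFn ∈ FP :=
  comp_mem_FP eqValFn_mem_FP (fanoutFn_mem_FP fstF_mem_FP (comp_mem_FP fstF_mem_FP sndF_mem_FP))

/-- `headEqFn` is one-bit. [folklore] -/
theorem oneBit_headEqFn : OneBit headEqFn := oneBit_eqValFn.comp _

/-- `headEqFn` on a pair. [folklore] -/
@[simp] theorem headEqFn_boolPair (q item : List Bool) :
    headEqFn (boolPair q item) = [decide (bitsToNat q = bitsToNat (fstF item))] := by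
  simp [headEqFn, fstF, sndF]

/-- **`memHeadFn ⟨q, L⟩ = [∃ item ∈ decNil L, ⟦fstF item⟧ = ⟦q⟧]`**: the value `⟦q⟧` occurs as the
first field of some item of the coded list `L` (a lookup among the heads of a list of records).
[folklore] -/
noncomputable def memHeadFn : List Bool → List Bool := anyFn headEqFn

/-- `memHeadFn ∈ FP`. [folklore] -/
theorem memHeadFn_mem_FP : memHeadFn ∈ FP := anyFn_mem_FP headEqFn_mem_FP oneBit_headEqFn

/-- `memHeadFn` is one-bit. [folklore] -/
theorem oneBit_memHeadFn : OneBit memHeadFn := oneBit_anyFn oneBit_headEqFn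

/-- **Value of `memHeadFn` on a pair.** [folklore] -/
theorem memHeadFn_boolPair (q L : List Bool) :
    memHeadFn (boolPair q L) = [decide (∃ item ∈ decNil L, bitsToNat (fstF item) = bitsToNat q)] := by
  rw [memHeadFn, anyFn_boolPair oneBit_headEqFn]
  congr 1
  simp [eq_comm]

/-! ### The product of a coded list of numerals -/

/-- The step of `prodListFn`: `⟨u, ⟨a, acc⟩⟩ ↦ encodeNat (⟦a⟧ ⟦acc⟧)`. [folklore] -/
noncomputable def prodStep : List Bool → List Bool := prodFn ∘ sndF

/-- `prodStep ∈ FP`. [folklore] -/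
theorem prodStep_mem_FP : prodStep ∈ FP := comp_mem_FP prodFn_mem_FP sndF_mem_FP

/-- `prodStep` on a step argument. [folklore] -/
@[simp] theorem prodStep_apply (u a acc : List Bool) :
    prodStep (boolPair u (boolPair a acc)) = encodeNat (bitsToNat a * bitsToNat acc) := by
  simp [prodStep, sndF]

/-- `prodStep` has growth `0`: `|encodeNat (⟦a⟧ ⟦acc⟧)| ≤ |a| + |acc|`. [folklore] -/
theorem foldGrowth_prodStep : FoldGrowth 0 prodStep := fun v => by
  have h : prodStep v = encodeNat (bitsToNat (fstF (sndF v)) * bitsToNat (sndF (sndF v))) := rfl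
  rw [h]
  have := length_encodeNat_mul_le (fstF (sndF v)) (sndF (sndF v))
  omega

/-- **`prodListFn ⟨x, L⟩ = encodeNat (∏ a ∈ decNil L, ⟦a⟧)`**: the product of the values of the items
of a coded list (the first field `x` is ignored). [cite: AroraBarak2009, §1.3 (bounded loops)] -/
noncomputable def prodListFn : List Bool → List Bool := foldFn prodStep (fun _ => [true])

/-- **`prodListFn ∈ FP`.** [cite: AroraBarak2009, §1.3] -/
theorem prodListFn_mem_FP : prodListFn ∈ FP :=
  foldFn_mem_FP prodStep_mem_FP (const_mem_FP _) foldGrowth_prodStep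

/-- The left fold of the product step from a numeral. [folklore] -/
theorem foldl_prodStep (w : List Bool) : ∀ (l : List (List Bool)) (m : ℕ),
    l.foldl (fun acc a => prodStep (boolPair w (boolPair a acc))) (encodeNat m) =
      encodeNat (m * (l.map bitsToNat).prod)
  | [], m => by simp
  | a :: l, m => by
    rw [List.foldl_cons, prodStep_apply, bitsToNat_encodeNat, foldl_prodStep w l]
    simp [Nat.mul_comm, Nat.mul_left_comm]

/-- **Value of `prodListFn` on every input.** [folklore] -/
theorem prodListFn_apply (w : List Bool) :
    prodListFn w = encodeNat ((decNil (sndF w)).map bitsToNat).prod := by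
  have h1 : ([true] : List Bool) = encodeNat 1 := by decide
  rw [prodListFn, foldFn_apply, h1, foldl_prodStep, Nat.one_mul]

/-- **Value of `prodListFn` on a pair.** [folklore] -/
@[simp] theorem prodListFn_boolPair (x L : List Bool) :
    prodListFn (boolPair x L) = encodeNat ((decNil L).map bitsToNat).prod := by
  rw [prodListFn_apply]; simp [sndF]

end Brick

end Literature.Computability.Complexity
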